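import Summits.BirchSwinnertonDyer.BirchSwinnertonDyer.Theorems.KimAtThreeD7uTamagawaDescent
import HarnessLib

/-!
# The TAMAGAWA-DIVISIBLE bad places, VI: the LEVEL-`p^n` count
# `#{x ∈ E[p^n]^{I_v} : (φ−1)x ∈ core} = #{x ∈ E[p^n]^{I_v} : x ∈ core} · #Φ_v[p^n]`, and two index identities
# (cell `bsd-addord`, seat w2-tamdiv gen 4; route W2 `KimAtThreeKolyvagin`, items 19562 / 19560, «TamDiv∞»,
# POSITIVE exponent)

HONEST FRAMING: TOOL theorems (no definition, no named fact, no `sorry`); closes nothing by itself;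
nothing is booked; BSD is not proved by any of this.  Continues parts I–IV (`KimAtThreeD7uTamagawaCore`,
`…CoreFrobenius`, `…Component`, `…Descent`).  With `F = E[p^n]^{I_v}`, `S = F ∩ core = π_n(T_pE^{I_v})`
(part I), the cohomological side (part V, sequel VII) gives `#H¹_ur(K_v, E[p^n]) / #𝓕_u = [F : S + (φ−1)F]`;
this file turns that index into the component group.

## What (any number field `K`, `v ∤ p`, `𝔓₀ = adicCompletionPrime K v`, `φ` an arithmetic Frobenius at `𝔓₀`)

* §0 (pure algebra, finite abelian groups) `natCard_range_eq_natCard_map_mul_index`: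
  `#f(G) = #f(S) · [G : S + ker f]`; `index_sup_range_eq_relIndex_comap`: for an endomorphism `ψ` with
  `ψ(S) ⊆ S`, `[G : S + ψ(G)] = [ψ⁻¹(S) : S]`.
* §1 `core_nsmul`, `exists_core_pow_nsmul_eq_of_core` (bookkeeping on the core).
* §2 **`natCard_level_frobSub_core_eq`**: for every `n`,
  `#{x ∈ E[p^∞]^{I} : p^n x = 0, (φ−1)x ∈ core} = #{x ∈ E[p^∞]^{I} : p^n x = 0, x ∈ core} · #Φ_v[p^n]`
  — the map `x ↦ x − c` (`c ∈ core` with `(φ−1)c = (φ−1)x`, part II) identifies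
  `{x : (φ−1)x ∈ core}/{x ∈ core}` with `{t ∈ E[p^∞]^{D} : p^n t ∈ core}/{t ∈ E[p^∞]^{D} ∩ core}`, which
  part IV counts as `Φ_v[p^n]` (`Φ_v = X(K_v)/X₀(K_v)` on the minimal model, `#Φ_v = c_v`).  This is the
  finite-level form of `(E[p^∞]^{I}/core)^{Fr} ≅ Φ_v[p^∞]` (Grothendieck, SGA 7 IX 11.6–11.7), i.e. of the
  `p`-part of the Tamagawa factor in Rubin's Lemma 1.3.5 / Büyükboduk 2009 §2.1.2 Remark 2.

Sequel: `KimAtThreeD7uTamagawaIndex` (`#𝓕_can(w)_k = #𝓕_u(w)_k · #Φ_w[p^{k+1}]` over `ℚ`).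
References: K. Rubin, *Euler Systems* (2000) Lemma 1.3.5; K. Büyükboduk, JNT 129 (2009) §2.1.2 Remark 2;
B. Mazur, K. Rubin, Mem. AMS 799 (2004) Prop. 6.2.6; A. Grothendieck, SGA 7 I, Exp. IX §11.
-/

noncomputable section

-- the cell's Theorems namespace `Summit.BirchSwinnertonDyer.BirchSwinnertonDyer.…` repeats the summit name by design (D-0017)
set_option linter.dupNamespace false

open scoped Classical NNReal NumberField
open Function Field IsDedekindDomain NumberField WeierstrassCurve
open Literature.NumberTheory.EllipticCurves Literature.NumberTheory.EllipticCurves.GreenbergSelmer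
open Literature.NumberTheory.GaloisRepresentations
open Summit.BirchSwinnertonDyer.Rank1Residual.GaloisImage
open Summit.BirchSwinnertonDyer.Rank1Residual.GaloisImage.InertiaDivisible
open Summit.BirchSwinnertonDyer.BirchSwinnertonDyer.Theorems.KimAtThreeD7uTamagawaCore
open Summit.BirchSwinnertonDyer.BirchSwinnertonDyer.Theorems.KimAtThreeD7uTamagawaComponent

namespace Summit.BirchSwinnertonDyer.BirchSwinnertonDyer.Theorems.KimAtThreeD7uTamagawaLevel

/-! ### §0 Two index identities for finite abelian groups -/

section Algebra

variable {G H : Type*} [AddCommGroup G] [AddCommGroup H]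

/-- `#f(G) = #f(S) · [G : S + ker f]` for a homomorphism `f` out of an abelian group and a subgroup
`S` (`f(G) ≅ G/ker f`, `f(S) ≅ (S + ker f)/ker f`). [folklore] -/
theorem natCard_range_eq_natCard_map_mul_index (f : G →+ H) (S : AddSubgroup G) :
    Nat.card f.range = Nat.card (S.map f) * (S ⊔ f.ker).index := by
  have h1 : f.ker.index = Nat.card f.range := AddSubgroup.index_ker f
  have h2 : f.ker.relIndex (S ⊔ f.ker) * (S ⊔ f.ker).index = f.ker.index :=
    AddSubgroup.relIndex_mul_index le_sup_right
  have h3 : f.ker.relIndex (S ⊔ f.ker) = Nat.card ((S ⊔ f.ker).map f) :=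
    AddSubgroup.relIndex_ker (S ⊔ f.ker) f
  have hker : f.ker.map f = ⊥ := (AddSubgroup.map_eq_bot_iff _).mpr le_rfl
  have h4 : (S ⊔ f.ker).map f = S.map f := by rw [AddSubgroup.map_sup, hker, sup_bot_eq]
  calc Nat.card f.range = f.ker.index := h1.symm
    _ = f.ker.relIndex (S ⊔ f.ker) * (S ⊔ f.ker).index := h2.symm
    _ = Nat.card (S.map f) * (S ⊔ f.ker).index := by rw [h3, h4]

/-- `[G : S + ψ(G)] = [ψ⁻¹(S) : S]` for an endomorphism `ψ` of a finite abelian group and a subgroup `S` with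
`ψ(S) ⊆ S` (both count `#coker` resp. `#ker` of the endomorphism of `G/S` induced by `ψ`). [folklore] -/
theorem index_sup_range_eq_relIndex_comap [Finite G] (ψ : G →+ G) (S : AddSubgroup G)
    (hS : ∀ s ∈ S, ψ s ∈ S) :
    (S ⊔ ψ.range).index = S.relIndex (S.comap ψ) := by
  let q : G →+ G ⧸ S := (QuotientAddGroup.mk' S).comp ψ
  have hqker : q.ker = S.comap ψ := by
    ext x
    rw [AddMonoidHom.mem_ker, AddSubgroup.mem_comap, AddMonoidHom.comp_apply,
      QuotientAddGroup.mk'_apply, QuotientAddGroup.eq_zero_iff]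
  have hSbot : S.map (QuotientAddGroup.mk' S) = ⊥ :=
    (AddSubgroup.map_eq_bot_iff _).mpr (by rw [QuotientAddGroup.ker_mk'])
  have hqrange : q.range = (S ⊔ ψ.range).map (QuotientAddGroup.mk' S) := by
    rw [AddSubgroup.map_sup, hSbot, bot_sup_eq]
    exact AddMonoidHom.range_comp _ _
  -- `[ψ⁻¹(S)-index] = #range q = [S ⊔ ψ(G) : S]`
  have h1 : (S.comap ψ).index = Nat.card q.range := by rw [← hqker]; exact AddSubgroup.index_ker q
  have h2 : Nat.card q.range = S.relIndex (S ⊔ ψ.range) := by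
    rw [hqrange, ← AddSubgroup.relIndex_ker, QuotientAddGroup.ker_mk']
  have h3 : S.relIndex (S ⊔ ψ.range) * (S ⊔ ψ.range).index = S.index :=
    AddSubgroup.relIndex_mul_index le_sup_left
  have hle : S ≤ S.comap ψ := fun s hs => by rw [AddSubgroup.mem_comap]; exact hS s hs
  have h4 : S.relIndex (S.comap ψ) * (S.comap ψ).index = S.index := AddSubgroup.relIndex_mul_index hle
  haveI : (S.comap ψ).FiniteIndex := AddSubgroup.finiteIndex_of_finite
  have h0 : (S.comap ψ).index ≠ 0 := AddSubgroup.FiniteIndex.index_ne_zero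
  apply Nat.eq_of_mul_eq_mul_left (Nat.pos_of_ne_zero h0)
  calc (S.comap ψ).index * (S ⊔ ψ.range).index
      = S.relIndex (S ⊔ ψ.range) * (S ⊔ ψ.range).index := by rw [h1, h2]
    _ = S.relIndex (S.comap ψ) * (S.comap ψ).index := by rw [h3, h4]
    _ = (S.comap ψ).index * S.relIndex (S.comap ψ) := mul_comm _ _

end Algebra

/-! ### §1 Bookkeeping on the core -/

section CoreLemmas

variable {K : Type} [Field K] [NumberField K] (W : WeierstrassCurve K) [W.IsElliptic] (p : ℕ)
  [hp : Fact p.Prime] {v : HeightOneSpectrum (𝓞 K)}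

omit [W.IsElliptic] hp in
/-- Natural multiples of core points are core points. [folklore] -/
theorem core_nsmul {x : W.geomPrimaryTorsion p}
    (hx : ∀ k : ℕ, ∃ y : W.geomPrimaryTorsion p,
      (∀ i ∈ (adicCompletionPrime K v).inertia (absoluteGaloisGroup K), i • y = y) ∧ p ^ k • y = x)
    (n : ℕ) :
    ∀ k : ℕ, ∃ y : W.geomPrimaryTorsion p,
      (∀ i ∈ (adicCompletionPrime K v).inertia (absoluteGaloisGroup K), i • y = y) ∧
        p ^ k • y = n • x := by
  intro k
  obtain ⟨y, hyI, hy⟩ := hx k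
  exact ⟨n • y, fun i hi => by rw [smul_comm, hyI i hi], by rw [smul_comm, hy]⟩

/-- `p^j`-th roots inside the core (iterate `exists_core_nsmul_eq_of_core`).
[cite: GreenbergLNM1716, §3 Lemma 3.3 (p. 87) with the remark after its proof (p. 88)] -/
theorem exists_core_pow_nsmul_eq_of_core (j : ℕ) {x : W.geomPrimaryTorsion p}
    (hx : ∀ k : ℕ, ∃ y : W.geomPrimaryTorsion p,
      (∀ i ∈ (adicCompletionPrime K v).inertia (absoluteGaloisGroup K), i • y = y) ∧ p ^ k • y = x) :
    ∃ r : W.geomPrimaryTorsion p,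
      (∀ k : ℕ, ∃ y : W.geomPrimaryTorsion p,
        (∀ i ∈ (adicCompletionPrime K v).inertia (absoluteGaloisGroup K), i • y = y) ∧ p ^ k • y = r) ∧
      p ^ j • r = x := by
  induction j generalizing x with
  | zero => exact ⟨x, hx, by rw [pow_zero, one_smul]⟩
  | succ j ih =>
    obtain ⟨r, hrc, hr⟩ := ih hx
    obtain ⟨r', hr'c, hr'⟩ := exists_core_nsmul_eq_of_core W p hrc
    exact ⟨r', hr'c, by rw [pow_succ, mul_smul, hr', hr]⟩

end CoreLemmas

/-! ### §2 The level-`p^n` count -/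

section Level

variable {K : Type} [Field K] [NumberField K] (W : WeierstrassCurve K) [W.IsElliptic] (p : ℕ)
  [hp : Fact p.Prime] {v : HeightOneSpectrum (𝓞 K)}

/-- **The level-`p^n` Tamagawa count.**  At a finite `v ∤ p` with `φ` an arithmetic Frobenius at `𝔓₀`,
for every `n`: `#{x ∈ E[p^∞]^{I} : p^n x = 0, (φ−1)x ∈ core} = #{x ∈ E[p^∞]^{I} : p^n x = 0, x ∈ core} · #Φ_v[p^n]`,
`Φ_v = X(K_v)/X₀(K_v)` on the minimal model.  PROOF: for `x` on the left, part II gives a core `c` with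
`(φ−1)c = (φ−1)x`; `t = x − c` is `D_{𝔓₀}`-fixed with `p^n t = −p^n c ∈ core`; `x ↦ t` is a surjective
homomorphism onto `{t ∈ E[p^∞]^{D} : p^n t ∈ core}/{t ∈ E[p^∞]^{D} : t ∈ core}` (a `t` comes from
`x = t − c₁`, `c₁` a core `p^n`-th root of `p^n t`) with kernel `{x ∈ core}`; part IV counts the target.
[cite: Rubin2000, Lemma 1.3.5] [cite: GreenbergLNM1716, §3 Lemma 3.3 (p. 87) and §4 proof of Thm. 4.1 (p. 74)] -/
theorem natCard_level_frobSub_core_eq (hpv : (p : 𝓞 K) ∉ v.asIdeal)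
    {φ : absoluteGaloisGroup K} (hφ : IsArithFrobAt (𝓞 K) φ (adicCompletionPrime K v)) (n : ℕ) :
    Nat.card {x : W.geomPrimaryTorsion p //
        (∀ i ∈ (adicCompletionPrime K v).inertia (absoluteGaloisGroup K), i • x = x) ∧ p ^ n • x = 0 ∧
        ∀ k : ℕ, ∃ y : W.geomPrimaryTorsion p,
          (∀ i ∈ (adicCompletionPrime K v).inertia (absoluteGaloisGroup K), i • y = y) ∧
            p ^ k • y = φ • x - x} =
      Nat.card {x : W.geomPrimaryTorsion p //
        (∀ i ∈ (adicCompletionPrime K v).inertia (absoluteGaloisGroup K), i • x = x) ∧ p ^ n • x = 0 ∧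
        ∀ k : ℕ, ∃ y : W.geomPrimaryTorsion p,
          (∀ i ∈ (adicCompletionPrime K v).inertia (absoluteGaloisGroup K), i • y = y) ∧
            p ^ k • y = x} *
      Nat.card (AddSubgroup.torsionBy
        (((W.localMinimalIntegralModel v).baseChange (v.adicCompletion K)).toAffine.Point ⧸
          (W.localMinimalIntegralModel v).nonsingularReductionSubgroup
            (integers_valuationRing_valuation (v.adicCompletionIntegers K) (v.adicCompletion K)))
        (p ^ n : ℕ)) := by
  have hpp : (p : ℕ).Prime := hp.out
  set I : Subgroup (absoluteGaloisGroup K) := (adicCompletionPrime K v).inertia (absoluteGaloisGroup K)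
    with hIdef
  set Dv : Subgroup (absoluteGaloisGroup K) :=
    (adicCompletionPrime K v).decompositionSubgroup (absoluteGaloisGroup K) with hDvdef
  have hφD : φ ∈ Dv := hφ.mem_stabilizer
  have hIle : I ≤ Dv := Ideal.inertia_le_decompositionSubgroup _ _
  let Tor := W.geomPrimaryTorsion p
  let P : Tor → Prop := fun x => ∀ k : ℕ, ∃ y : Tor, (∀ i ∈ I, i • y = y) ∧ p ^ k • y = x
  have hPI : ∀ {x : Tor}, P x → ∀ i ∈ I, i • x = x := fun hx i hi => smul_eq_of_core W p hx hi
  -- `Ngrp = {t ∈ E[p^∞]^{D} : p^n t ∈ core}`, `C₀ = Ngrp ∩ core`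
  let Ngrp : AddSubgroup Tor :=
    { carrier := {t | (∀ d ∈ Dv, d • t = t) ∧ P (p ^ n • t)}
      add_mem' := fun {a b} ha hb ↦ ⟨fun d hd ↦ by rw [smul_add, ha.1 d hd, hb.1 d hd],
        by rw [smul_add]; exact core_add W p ha.2 hb.2⟩
      zero_mem' := ⟨fun d _ ↦ smul_zero d, by rw [smul_zero]; exact core_zero W p⟩
      neg_mem' := fun {a} ha ↦ ⟨fun d hd ↦ by rw [smul_neg, ha.1 d hd],
        by rw [smul_neg]; exact core_neg W p ha.2⟩ }
  have hNmem : ∀ t : Tor, t ∈ Ngrp ↔ (∀ d ∈ Dv, d • t = t) ∧ P (p ^ n • t) := fun _ ↦ Iff.rfl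
  let C₀ : AddSubgroup Ngrp :=
    { carrier := {t | P (t : Tor)}
      add_mem' := fun {a b} ha hb ↦ by
        change P ((a : Tor) + b); exact core_add W p ha hb
      zero_mem' := by change P (0 : Tor); exact core_zero W p
      neg_mem' := fun {a} ha ↦ by change P (-(a : Tor)); exact core_neg W p ha }
  have hC₀mem : ∀ t : Ngrp, t ∈ C₀ ↔ P (t : Tor) := fun _ ↦ Iff.rfl
  -- `Fgrp = {x ∈ E[p^∞]^{I} : p^n x = 0, (φ−1)x ∈ core}`
  let Fgrp : AddSubgroup Tor :=
    { carrier := {x | (∀ i ∈ I, i • x = x) ∧ p ^ n • x = 0 ∧ P (φ • x - x)}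
      add_mem' := fun {a b} ha hb ↦ ⟨fun i hi ↦ by rw [smul_add, ha.1 i hi, hb.1 i hi],
        by rw [smul_add, ha.2.1, hb.2.1, add_zero], by
          have e : φ • (a + b) - (a + b) = (φ • a - a) + (φ • b - b) := by rw [smul_add]; abel
          rw [e]; exact core_add W p ha.2.2 hb.2.2⟩
      zero_mem' := ⟨fun i _ ↦ smul_zero i, smul_zero _, by
        rw [smul_zero, sub_zero]; exact core_zero W p⟩
      neg_mem' := fun {a} ha ↦ ⟨fun i hi ↦ by rw [smul_neg, ha.1 i hi],
        by rw [smul_neg, ha.2.1, neg_zero], by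
          have e : φ • (-a) - (-a) = -(φ • a - a) := by rw [smul_neg]; abel
          rw [e]; exact core_neg W p ha.2.2⟩ }
  have hFmem : ∀ x : Tor, x ∈ Fgrp ↔ (∀ i ∈ I, i • x = x) ∧ p ^ n • x = 0 ∧ P (φ • x - x) :=
    fun _ ↦ Iff.rfl
  -- finiteness
  haveI hNfin : Finite Ngrp := by
    have hfin := finite_setOf_forall_decompositionSubgroup_smul_eq W p hpv (v := v)
    haveI := hfin.to_subtype
    refine Finite.of_injective (fun t : Ngrp ↦ (⟨(t : Tor), t.2.1⟩ :
      {t : Tor | ∀ d ∈ (adicCompletionPrime K v).decompositionSubgroup (absoluteGaloisGroup K), d • t = t}))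
      fun a b hab ↦ by
        have h := congrArg Subtype.val hab
        exact Subtype.ext h
  haveI hFfin : Finite Fgrp := by
    have hne : ((p ^ n : ℕ) : ℤ) ≠ 0 := by exact_mod_cast pow_ne_zero n hpp.ne_zero
    haveI : Finite (geomTorsion W ((p ^ n : ℕ) : ℤ)) := finite_torsionPoints_holds W (AlgebraicClosure K) hne
    let ι : Fgrp → geomTorsion W ((p ^ n : ℕ) : ℤ) := fun y ↦
      ⟨((y : Tor) : W.geomPoints), by
        rw [mem_geomTorsion_iff, natCast_zsmul]
        have h := y.2.2.1
        have h' := congrArg (fun z : Tor ↦ (z : W.geomPoints)) h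
        simpa only [AddSubmonoidClass.coe_nsmul, ZeroMemClass.coe_zero] using h'⟩
    refine Finite.of_injective ι fun a b hab ↦ ?_
    have h := congrArg (fun z : geomTorsion W ((p ^ n : ℕ) : ℤ) ↦ (z : W.geomPoints)) hab
    exact Subtype.ext (Subtype.ext h)
  -- the core partner `c x` of `x ∈ Fgrp`: `(φ−1)(c x) = (φ−1)x`
  choose c hcP hc using fun x : Fgrp ↦ exists_core_frob_smul_sub_eq W p hpv hφ (φ • (x : Tor) - x) x.2.2.2
  -- `t x = x − c x ∈ Ngrp`
  have ht : ∀ x : Fgrp, ((x : Tor) - c x) ∈ Ngrp := by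
    intro x
    have hxI : ∀ i ∈ I, i • ((x : Tor) - c x) = (x : Tor) - c x := fun i hi ↦ by
      rw [smul_sub, x.2.1 i hi, hPI (hcP x) i hi]
    have hφx : φ • ((x : Tor) - c x) = (x : Tor) - c x := by
      have e : φ • ((x : Tor) - c x) - ((x : Tor) - c x) = (φ • (x : Tor) - x) - (φ • c x - c x) := by
        rw [smul_sub]; abel
      rw [hc x, sub_self] at e
      exact sub_eq_zero.mp e
    refine ⟨fun d hd ↦ smul_eq_of_mem_decompositionSubgroup_of_inertia_of_frob W p v hφ hxI hφx hd, ?_⟩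
    rw [smul_sub, x.2.2.1, zero_sub]
    exact core_neg W p (core_nsmul W p (hcP x) (p ^ n))
  -- the homomorphism `γ : Fgrp → Ngrp/C₀`
  let γ : Fgrp →+ Ngrp ⧸ C₀ :=
    { toFun := fun x ↦ QuotientAddGroup.mk ⟨(x : Tor) - c x, ht x⟩
      map_zero' := by
        rw [QuotientAddGroup.eq_zero_iff]
        change P (((0 : Fgrp) : Tor) - c 0)
        rw [ZeroMemClass.coe_zero]
        exact core_sub W p (core_zero W p) (hcP 0)
      map_add' := fun x y ↦ by
        rw [← QuotientAddGroup.mk_add, QuotientAddGroup.eq_iff_sub_mem]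
        change P ((((x + y : Fgrp) : Tor) - c (x + y)) - ((((x : Fgrp) : Tor) - c x) + (((y : Fgrp) : Tor) - c y)))
        have e : (((x + y : Fgrp) : Tor) - c (x + y)) - ((((x : Fgrp) : Tor) - c x) + (((y : Fgrp) : Tor) - c y)) =
            c x + c y - c (x + y) := by rw [AddSubgroup.coe_add]; abel
        rw [e]
        exact core_sub W p (core_add W p (hcP x) (hcP y)) (hcP (x + y)) }
  have hγ : ∀ x : Fgrp, γ x = QuotientAddGroup.mk ⟨(x : Tor) - c x, ht x⟩ := fun _ ↦ rfl
  -- kernel of `γ` = core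
  have hker : ∀ x : Fgrp, x ∈ γ.ker ↔ P (x : Tor) := by
    intro x
    rw [AddMonoidHom.mem_ker, hγ, QuotientAddGroup.eq_zero_iff]
    change P ((x : Tor) - c x) ↔ P (x : Tor)
    constructor
    · intro h
      have h' := core_add W p h (hcP x)
      rwa [sub_add_cancel] at h'
    · intro h; exact core_sub W p h (hcP x)
  -- `γ` is surjective
  have hsurj : Function.Surjective γ := by
    intro q
    obtain ⟨t, rfl⟩ := QuotientAddGroup.mk_surjective q
    obtain ⟨c₁, hc₁P, hc₁⟩ := exists_core_pow_nsmul_eq_of_core W p n t.2.2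
    have htI : ∀ i ∈ I, i • (t : Tor) = t := fun i hi ↦ t.2.1 i (hIle hi)
    set x₀ : Tor := (t : Tor) - c₁ with hx₀
    have hx₀F : x₀ ∈ Fgrp := by
      refine ⟨fun i hi ↦ by rw [hx₀, smul_sub, htI i hi, hPI hc₁P i hi], ?_, ?_⟩
      · rw [hx₀, smul_sub, hc₁, sub_self]
      · have e : φ • x₀ - x₀ = -(φ • c₁ - c₁) := by
          rw [hx₀, smul_sub, t.2.1 φ hφD]; abel
        rw [e]
        exact core_neg W p (core_sub W p (core_smul_of_mem_decompositionSubgroup W p hc₁P hφD) hc₁P)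
    refine ⟨⟨x₀, hx₀F⟩, ?_⟩
    rw [hγ, QuotientAddGroup.eq_iff_sub_mem]
    change P ((x₀ - c ⟨x₀, hx₀F⟩) - (t : Tor))
    have e : (x₀ - c ⟨x₀, hx₀F⟩) - (t : Tor) = -c₁ - c ⟨x₀, hx₀F⟩ := by
      set c' := c ⟨x₀, hx₀F⟩ with hc'
      rw [hx₀]; abel
    rw [e]
    exact core_sub W p (core_neg W p hc₁P) (hcP _)
  -- counting
  haveI : Nonempty C₀ := ⟨0⟩
  have h1 : Nat.card Fgrp = Nat.card γ.ker * Nat.card γ.range := by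
    rw [← Nat.card_congr (QuotientAddGroup.quotientKerEquivRange γ).toEquiv, mul_comm]
    exact AddSubgroup.card_eq_card_quotient_mul_card_addSubgroup γ.ker
  have h2 : Nat.card γ.range = Nat.card (Ngrp ⧸ C₀) := by
    rw [AddMonoidHom.range_eq_top.mpr hsurj]; exact Nat.card_congr AddSubgroup.topEquiv.toEquiv
  have h3 : Nat.card Ngrp = Nat.card (Ngrp ⧸ C₀) * Nat.card C₀ :=
    AddSubgroup.card_eq_card_quotient_mul_card_addSubgroup C₀
  have h4 : Nat.card Ngrp = Nat.card {t : Tor //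
      (∀ d ∈ (adicCompletionPrime K v).decompositionSubgroup (absoluteGaloisGroup K), d • t = t) ∧ P t} *
      Nat.card (AddSubgroup.torsionBy
        (((W.localMinimalIntegralModel v).baseChange (v.adicCompletion K)).toAffine.Point ⧸
          (W.localMinimalIntegralModel v).nonsingularReductionSubgroup
            (integers_valuationRing_valuation (v.adicCompletionIntegers K) (v.adicCompletion K)))
        (p ^ n : ℕ)) := by
    rw [← natCard_decompositionFixed_nsmul_core_eq W p hpv n]
    exact Nat.card_congr (Equiv.subtypeEquivRight fun _ ↦ Iff.rfl)
  have h5 : Nat.card C₀ = Nat.card {t : Tor //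
      (∀ d ∈ (adicCompletionPrime K v).decompositionSubgroup (absoluteGaloisGroup K), d • t = t) ∧ P t} := by
    refine Nat.card_congr ?_
    exact
      { toFun := fun t ↦ ⟨((t : Ngrp) : Tor), (t : Ngrp).2.1, t.2⟩
        invFun := fun t ↦ ⟨⟨t.1, t.2.1, core_nsmul W p t.2.2 (p ^ n)⟩, t.2.2⟩
        left_inv := fun t ↦ rfl
        right_inv := fun t ↦ rfl }
  have h6 : Nat.card γ.ker = Nat.card {x : Tor // (∀ i ∈ I, i • x = x) ∧ p ^ n • x = 0 ∧ P x} := by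
    refine Nat.card_congr ?_
    exact
      { toFun := fun x ↦ ⟨((x : Fgrp) : Tor), (x : Fgrp).2.1, (x : Fgrp).2.2.1, (hker _).mp x.2⟩
        invFun := fun x ↦ ⟨⟨x.1, x.2.1, x.2.2.1,
            core_sub W p (core_smul_of_mem_decompositionSubgroup W p x.2.2.2 hφD) x.2.2.2⟩,
          (hker _).mpr x.2.2.2⟩
        left_inv := fun x ↦ rfl
        right_inv := fun x ↦ rfl }
  have h7 : Nat.card Fgrp = Nat.card {x : Tor //
      (∀ i ∈ I, i • x = x) ∧ p ^ n • x = 0 ∧ P (φ • x - x)} :=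
    Nat.card_congr (Equiv.subtypeEquivRight fun _ ↦ Iff.rfl)
  have hC0 : Nat.card C₀ ≠ 0 := (Nat.card_pos (α := C₀)).ne'
  have hq : Nat.card (Ngrp ⧸ C₀) = Nat.card (AddSubgroup.torsionBy
        (((W.localMinimalIntegralModel v).baseChange (v.adicCompletion K)).toAffine.Point ⧸
          (W.localMinimalIntegralModel v).nonsingularReductionSubgroup
            (integers_valuationRing_valuation (v.adicCompletionIntegers K) (v.adicCompletion K)))
        (p ^ n : ℕ)) := by
    apply Nat.eq_of_mul_eq_mul_left (Nat.pos_of_ne_zero hC0)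
    rw [mul_comm, ← h3, h4, h5]
  rw [← h7, h1, h6, h2, hq]

end Level

end Summit.BirchSwinnertonDyer.BirchSwinnertonDyer.Theorems.KimAtThreeD7uTamagawaLevel

end
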